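import Summits.ResolutionOfSingularities.ResolutionOfSingularities.Theorems.EquisingularLiftEquisingularLiftBlowupModelFour
import Literature.AlgebraicGeometry.Resolution.ProjectiveBirationalBlowupProofs
import Literature.AlgebraicGeometry.Resolution.AlterationsNormalizationReduction
import Literature.AlgebraicGeometry.Resolution.SurfaceResolutionReduction
import Literature.AlgebraicGeometry.Resolution.NormalizationOfVarietiesProofs
import HarnessLib

/-!
# Crux `EquisingularLift` (stmt-ResolutionOfSingularities-15660), line `Sketch` (skeleton v10c `f3e6993bf39ec5c9`):
# regular blow-up models of integral projective CURVES — the `n = 2` companion of the leaves `stub_blowupModel_three/_four`,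
# UNCONDITIONAL in every characteristic

[OURS · leafhand-res-equisingularlift-6 g1, 2026-08-31] AI-produced, weaker than expert review; NOT a statement of any
manuscript; nothing here proves resolution of singularities in positive characteristic, and NO registered stub is closed.

The line's downstairs predicate «`H` has a non-zero ideal sheaf ALL of whose blow-ups are regular» (a regular blow-up
model; = a PROJECTIVE resolution, `…BlowupModelProjectiveResolution`) is in the tree for `n = 3` modulo CJS / Lipman and for
`n = 4` modulo Cossart–Piltant, and is the OPEN residual for `n ≥ 5`.  This file proves it UNCONDITIONALLY for curves,
over every field:

* `blowupModel_of_curve` — every integral closed `H ⊆ ℙⁿ_k` of dimension `≤ 1` has a regular blow-up model: the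
  normalization `H^ν → H` (E. Noether finiteness, DISCHARGED `NoetherFiniteIntegralClosure_holds`) is finite (hence proper),
  birational (`isBirational_normalizationι`) with regular source (`isRegular_normalization_of_dim_le_one`: normal of
  dimension `≤ 1` ⇒ regular) and PROJECTIVE over `k` (`isProjectiveOver_normalization`), so by Liu 2002 Thm. 8.1.24
  (DISCHARGED, `Liu2002Thm8124Projective_holds`) it is the blow-up of a non-zero ideal sheaf, all of whose blow-ups are
  isomorphic to `H^ν` (`IsBlowup.unique`);
* `blowupModel_two` — the `n = 2` text of the line's leaves (the registered binder list of `stub_blowupModel_three` with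
  `n = 2` in place of `n = 3`): `ι` an isomorphism ⇒ `H ≅ ℙ²_k` regular, `𝔞 = ⊤`; otherwise `H` is an integral plane curve
  (`topologicalKrullDim_of_hypersurface`);
* `blowupModel_le_two` — the same for every `n ≤ 2` (`n ≤ 1`: `H` is `ℙⁿ_k` or a curve/point of dimension `≤ 1`).

Honest label: the crux's `n ≤ 2` instances were already settled in EL currency (`equisingularLift_of_le_two`); this file
settles the LINE's own downstairs currency there, so that «regular blow-up models of integral hypersurfaces of `ℙⁿ_k̄`»
is now: PROVED `n ≤ 2` · conditional `n = 3, 4` · OPEN `n ≥ 5`.  `--supports stmt-ResolutionOfSingularities-15660 --as helper`,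
DEF-FREE, standard axioms, zero named hypotheses.

References: [Liu2002, Thm. 8.1.24, Prop. 4.1.12]; [Hartshorne1977, II.7.17, V Rem. 3.8.1]; [Kollar2007, §1.4 Thm. 1.30, 1.33].
-/

set_option linter.dupNamespace false -- mandated namespace `Summit.<Summit>.<Problem>` of this single-conjunct summit

noncomputable section

open CategoryTheory CategoryTheory.Limits AlgebraicGeometry TopologicalSpace
open Literature.AlgebraicGeometry.Resolution Literature.AlgebraicGeometry.Motives

universe u

namespace Summit.ResolutionOfSingularities.ResolutionOfSingularities.Cruxes.EquisingularLift.StrataSplit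

/-! ## Curves: the normalization is a regular projective blow-up model -/

/-- **Every integral projective curve over a field has a regular blow-up model.** For a field `k` and an integral closed
`ι : H ↪ ℙⁿ_k` with `dim H ≤ 1` there is an ideal sheaf `𝔞 ≠ ⊥` on `H` all of whose blow-ups are regular: the normalization
`H^ν → H` is finite, birational, with regular source (normal Noetherian of dimension `≤ 1`) and projective over `k`, hence
(Liu 2002 Thm. 8.1.24, discharged in the tree) a blow-up along a non-zero ideal sheaf, unique up to isomorphism.
[cite: Liu2002, Thm. 8.1.24] [cite: Kollar2007, §1.4 Thm. 1.30, Thm. 1.33] -/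
theorem blowupModel_of_curve {k : Type u} [Field k] {n : ℕ} {H : Scheme.{u}} [IsIntegral H]
    (ι : H ⟶ (projectiveSpace n k).left) [IsClosedImmersion ι] (hdim : topologicalKrullDim H ≤ 1) :
    ∃ 𝔞 : H.IdealSheafData, 𝔞 ≠ ⊥ ∧ ∀ (Z : Scheme.{u}) (π : Z ⟶ H), IsBlowup π 𝔞 → Scheme.IsRegular Z := by
  haveI : IsProper (projectiveSpace n k).hom := isProper_projectiveSpace n k
  let f : H ⟶ Spec (.of k) := ι ≫ (projectiveSpace n k).hom
  have hHproj : IsProjectiveOver (Over.mk f) := ⟨n, Over.homMk ι rfl, ‹IsClosedImmersion ι›⟩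
  haveI : IsProper f := inferInstance
  -- the normalization: finite, birational, regular, projective over `k`
  haveI : IsFinite (normalizationι H) := isFinite_normalizationι H NoetherFiniteIntegralClosure_holds f
  have hreg : Scheme.IsRegular (normalization H) :=
    isRegular_normalization_of_dim_le_one H NoetherFiniteIntegralClosure_holds f hdim
  have hbir : IsBirational (normalizationι H) := isBirational_normalizationι H f
  have hνproj : IsProjectiveOver (Over.mk (normalizationι H ≫ f)) := isProjectiveOver_normalization (X := H) f hHproj
  -- Liu 8.1.24: a birational morphism of integral projective `k`-schemes is a blow-up of a non-zero ideal
  obtain ⟨I, hI0, hI⟩ := Liu2002Thm8124Projective_holds k (normalization H) H (normalizationι H)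
    (normalizationι H ≫ f) f inferInstance inferInstance hνproj hHproj rfl hbir
  refine ⟨I, hI0, fun Z π' hπ' => ?_⟩
  obtain ⟨e, -, -⟩ := hI.unique hπ'
  exact hreg.of_iso e.hom

/-! ## The `n = 2` text of the line's leaves, unconditional -/

/-- **Regular blow-up models for `n = 2` (plane curves), UNCONDITIONAL** — the binder list of the registered leaves
`stub_blowupModel_three` / `stub_blowupModel_four` with `n = 2`: for every prime `p`, algebraically closed `k` of characteristic
`p` (only "`k` a field" is used), integral closed `H ⊆ ℙ²_k` with locally principal ideal, there is `𝔞 ≠ ⊥` on `H` all of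
whose blow-ups are regular. If `ι` is an isomorphism, `H ≅ ℙ²_k` is regular and `𝔞 = ⊤`; otherwise `H` is an integral plane
curve (`topologicalKrullDim_of_hypersurface`) and `blowupModel_of_curve` applies. [cite: Liu2002, Thm. 8.1.24]
[cite: GortzWedhorn2020, Thm. 5.22 and Thm. 5.32] -/
theorem blowupModel_two : ∀ p : ℕ, p.Prime → ∀ (k : Type) [Field k] [CharP k p] [IsAlgClosed k] (n : ℕ) (H : AlgebraicGeometry.Scheme.{0}) (ι : H ⟶ (Literature.AlgebraicGeometry.Motives.projectiveSpace n k).left), AlgebraicGeometry.IsClosedImmersion ι → AlgebraicGeometry.IsIntegral H → (∀ y : (Literature.AlgebraicGeometry.Motives.projectiveSpace n k).left, ∃ U : (Literature.AlgebraicGeometry.Motives.projectiveSpace n k).left.affineOpens, y ∈ (U : (Literature.AlgebraicGeometry.Motives.projectiveSpace n k).left.Opens) ∧ (ι.ker.ideal U).IsPrincipal) → n = 2 → ∃ 𝔞 : H.IdealSheafData, 𝔞 ≠ ⊥ ∧ ∀ (Z : AlgebraicGeometry.Scheme.{0}) (π : Z ⟶ H), Literature.AlgebraicGeometry.Resolution.IsBlowup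 π 𝔞 → Literature.AlgebraicGeometry.Resolution.Scheme.IsRegular Z := by
  intro p hp k _ _ _ n H ι hι hH hloc hn
  subst hn
  haveI := hι
  haveI := hH
  by_cases hiso : IsIso ι
  · -- `H ≅ ℙ²_k` is regular
    exact exists_blowupModel_of_isRegular
      (Scheme.IsRegular.of_iso (inv ι) (isRegular_projectiveSpace 2 k))
  · -- `H` is an integral plane curve
    have hdim : topologicalKrullDim H ≤ 1 := by
      rw [topologicalKrullDim_of_hypersurface (n := 1) ι hloc hiso]; exact le_of_eq rfl
    exact blowupModel_of_curve ι hdim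

/-- **Regular blow-up models for every `n ≤ 2`, UNCONDITIONAL**: `n ≤ 1` — `dim H ≤ dim ℙⁿ_k = n ≤ 1` (a closed embedding
does not raise the Krull dimension; `dim ℙⁿ_k = n` by smoothness of relative dimension `n`), so `blowupModel_of_curve`
applies; `n = 2` — `blowupModel_two`. [cite: Liu2002, Thm. 8.1.24] [cite: GortzWedhorn2020, Thm. 5.22 and Thm. 5.32] -/
theorem blowupModel_le_two : ∀ p : ℕ, p.Prime → ∀ (k : Type) [Field k] [CharP k p] [IsAlgClosed k] (n : ℕ) (H : AlgebraicGeometry.Scheme.{0}) (ι : H ⟶ (Literature.AlgebraicGeometry.Motives.projectiveSpace n k).left), AlgebraicGeometry.IsClosedImmersion ι → AlgebraicGeometry.IsIntegral H → (∀ y : (Literature.AlgebraicGeometry.Motives.projectiveSpace n k).left, ∃ U : (Literature.AlgebraicGeometry.Motives.projectiveSpace n k).left.affineOpens, y ∈ (U : (Literature.AlgebraicGeometry.Motives.projectiveSpace n k).left.Opens) ∧ (ι.ker.ideal U).IsPrincipal) → n ≤ 2 → ∃ 𝔞 : H.IdealSheafData, 𝔞 ≠ ⊥ ∧ ∀ (Z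 : AlgebraicGeometry.Scheme.{0}) (π : Z ⟶ H), Literature.AlgebraicGeometry.Resolution.IsBlowup π 𝔞 → Literature.AlgebraicGeometry.Resolution.Scheme.IsRegular Z := by
  intro p hp k _ _ _ n H ι hι hH hloc hn
  haveI := hι
  haveI := hH
  rcases Nat.lt_or_ge n 2 with hlt | hge
  · -- `n ≤ 1`: `dim H ≤ dim ℙⁿ_k = n ≤ 1` (a closed embedding does not raise the dimension)
    haveI hint : IsIntegral (projectiveSpace n k).left := isIntegral_projectiveSpace n k
    haveI : SmoothOfRelativeDimension n (projectiveSpace n k).hom :=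
      (isSmoothProjective_projectiveSpace_holds k n).smoothOfRelativeDimension
    have hdimP : topologicalKrullDim ↥(projectiveSpace n k).left = (n : ℕ) :=
      topologicalKrullDim_eq_of_smoothOfRelativeDimension (projectiveSpace n k).hom n
    have hle : topologicalKrullDim H ≤ topologicalKrullDim ↥(projectiveSpace n k).left :=
      ι.isClosedEmbedding.isEmbedding.isInducing.topologicalKrullDim_le
    have hn1 : ((n : ℕ) : WithBot ℕ∞) ≤ 1 := by exact_mod_cast (show n ≤ 1 by omega)
    have hdim : topologicalKrullDim H ≤ 1 := (hle.trans hdimP.le).trans hn1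
    exact blowupModel_of_curve ι hdim
  · exact blowupModel_two p hp k n H ι hι hH hloc (le_antisymm hn hge)

end Summit.ResolutionOfSingularities.ResolutionOfSingularities.Cruxes.EquisingularLift.StrataSplit

end
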